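/-
Copyright (c) 2026. All rights reserved.
Released under Apache 2.0 license as described in the file LICENSE.
Authors: abc-iut cell, seat abc-iut-w5-d218 (gen 3).
-/
import Literature.GroupTheory.ProPFrattiniOpen
import Mathlib.GroupTheory.Schreier
import Mathlib.GroupTheory.Solvable

/-!
# Serre's theorem: finite-index subgroups of topologically finitely generated pro-`p` groups are open

J.-P. Serre, *Galois Cohomology*, I §4.2, Exercise 6; J. D. Dixon, M. du Sautoy, A. Mann, D. Segal,
*Analytic pro-`p` groups* (2nd ed.), Theorem 1.17: **in a topologically finitely generated pro-`p` group
every subgroup of finite index is open** ("strong completeness"; the pro-`p` case of the theorem of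
Nikolov–Segal recorded as the named fact `Literature.GroupTheory.NikolovSegalStatement`).

Proof (DdSMS 1.17).  Reduce to a normal subgroup `N` (normal core).  `G ⧸ N` is a finite `p`-group even
though `N` is abstract (`isPGroup_quotient_of_finiteIndex_of_proP`, `ProPPowerMap.lean`), say of order
`p ^ k`; induct on `k` over all topologically finitely generated pro-`p` groups at once.  The abstract
subgroup `Φ = [G,G]·Gᵖ` is OPEN (`ProPFrattiniOpen.lean`), so `N·Φ` is an open subgroup; if
`N·Φ = G` then `G ⧸ N` is a finite `p`-group equal to `[Q,Q]·Qᵖ`, hence trivial; otherwise `N·Φ` is an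
open subgroup of index `≥ p`, again topologically finitely generated (Schreier) and pro-`p`, in which `N`
is normal of index `p ^ j`, `j < k` — induction.

* `exists_finset_dense_closure_of_isOpen` — an open subgroup of a topologically finitely generated
  compact group is topologically finitely generated (Schreier's lemma for a dense finitely generated
  subgroup);
* `commutator_sup_closure_pow_ne_top` — for a nontrivial finite `p`-group `Q`, `[Q,Q]·Qᵖ ≠ Q`;
* `isOpen_of_normal_of_index_eq_pow_of_proP` — the induction;
* `isOpen_of_finiteIndex_of_proP` — **Serre's theorem**; `continuous_of_proP_of_finsetDense` — every
  homomorphism from such a group to a profinite group is continuous;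
* `nikolovSegalStatement_of_proP` — the statement in the exact shape of the named fact
  `NikolovSegalStatement`, with the pro-`p` hypothesis added, PROVED.

HONEST SCOPE (abc-iut): this does not prove the general Nikolov–Segal theorem (FACT-LIST F-1977 /
`NikolovSegalStatement`, used for `Gal(k̄/k)` of a `p`-adic field and for `π̂₁` of semi-graphs of
anabelioids — those groups are not pro-`p`); it discharges the pro-`p` instances (maximal pro-`l`
quotients, `ℤ_l(1) ⋊ ℤ_l`, free pro-`p` groups of finite rank).

[cite: SerreGaloisCohomology1997, I §4.2 Exercise 6] [cite: DDMSAnalyticProP1999, Thm 1.17]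
-/

namespace Literature.GroupTheory

open scoped Pointwise commutatorElement

universe u

section Schreier

variable {G : Type*} [Group G] [TopologicalSpace G] [IsTopologicalGroup G] [CompactSpace G]

/-- **Open subgroups of topologically finitely generated compact groups are topologically finitely
generated**: if a finitely generated subgroup `D` is dense in `G` and `V` is an open subgroup (of finite
index, `G` being compact), then `D ∩ V` has finite index in `D`, so is finitely generated (Schreier's
lemma, Mathlib `Subgroup.fg_of_index_ne_zero`), and it is dense in `V`.
[cite: DDMSAnalyticProP1999, Thm 1.17 (proof)] -/
theorem exists_finset_dense_closure_of_isOpen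
    (hfg : ∃ S : Finset G, Dense ((Subgroup.closure (S : Set G) : Subgroup G) : Set G))
    (V : Subgroup G) (hV : IsOpen (V : Set G)) :
    ∃ S' : Finset V, Dense ((Subgroup.closure (S' : Set V) : Subgroup V) : Set V) := by
  classical
  obtain ⟨S, hS⟩ := hfg
  set D : Subgroup G := Subgroup.closure (S : Set G) with hD
  haveI : Finite (G ⧸ V) := Subgroup.quotient_finite_of_isOpen V hV
  haveI : V.FiniteIndex := Subgroup.finiteIndex_of_finite_quotient
  set W : Subgroup D := V.subgroupOf D with hW
  haveI : Group.FG W := Subgroup.fg_of_index_ne_zero W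
  obtain ⟨T, hT⟩ := Group.fg_def.mp (inferInstance : Group.FG W)
  -- the inclusion `W = D ∩ V → V`
  let φ : W →* V := (D.subtype.comp W.subtype).codRestrict V
    fun w => Subgroup.mem_subgroupOf.mp w.2
  refine ⟨T.image φ, ?_⟩
  rw [Subtype.dense_iff]
  intro v hv
  have h1 : (V : Set G) ⊆ closure ((V : Set G) ∩ D) := hS.open_subset_closure_inter hV
  refine closure_mono ?_ (h1 hv)
  rintro g ⟨hgV, hgD⟩
  let w : W := ⟨⟨g, hgD⟩, Subgroup.mem_subgroupOf.mpr hgV⟩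
  have hw : w ∈ Subgroup.closure (T : Set W) := by rw [hT]; exact Subgroup.mem_top w
  have hφw : φ w ∈ Subgroup.closure ((T.image φ : Finset V) : Set V) := by
    rw [Finset.coe_image, ← MonoidHom.map_closure]
    exact Subgroup.mem_map_of_mem φ hw
  exact ⟨φ w, hφw, rfl⟩

end Schreier

section FinitePGroup

variable {Q : Type*} [Group Q] {p : ℕ}

/-- For a NONTRIVIAL finite `p`-group `Q`, the subgroup `[Q,Q]·Qᵖ` generated by commutators and
`p`-th powers is proper (it is the Frattini subgroup; here directly: `[Q,Q] ≠ Q` as `Q` is nilpotent,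
and on the nontrivial finite abelian `p`-group `Q ⧸ [Q,Q]` the `p`-power map is not surjective, while
`[Q,Q]·Qᵖ = Q` would make it surjective). [cite: DDMSAnalyticProP1999, Prop 1.16 (iii)] -/
theorem commutator_sup_closure_pow_ne_top [Finite Q] [hp : Fact p.Prime] (hQ : IsPGroup p Q)
    [Nontrivial Q] :
    (commutator Q ⊔ Subgroup.closure (Set.range fun x : Q => x ^ p) : Subgroup Q) ≠ ⊤ := by
  intro htop
  haveI : Group.IsNilpotent Q := hQ.isNilpotent
  have hlt : commutator Q < ⊤ := IsSolvable.commutator_lt_top_of_nontrivial Q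
  -- the abelianisation `A := Q ⧸ [Q,Q]` is a nontrivial finite `p`-group
  haveI : Nontrivial (Q ⧸ commutator Q) := by
    obtain ⟨x, hx⟩ : ∃ x : Q, x ∉ commutator Q := by
      by_contra h
      push Not at h
      exact hlt.ne (eq_top_iff.mpr fun x _ => h x)
    exact ⟨⟨QuotientGroup.mk x, 1, fun h => hx ((QuotientGroup.eq_one_iff x).mp h)⟩⟩
  have hA : IsPGroup p (Q ⧸ commutator Q) := hQ.to_quotient _
  -- the `p`-power map of `A` is surjective, since every `q` is `y ^ p * c`, `c ∈ [Q,Q]`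
  have hsurj : Function.Surjective fun a : Q ⧸ commutator Q => a ^ p := by
    intro a
    induction a using QuotientGroup.induction_on with
    | H q =>
      have hq : q ∈ ((commutator Q ⊔ Subgroup.closure (Set.range fun x : Q => x ^ p) :
          Subgroup Q) : Set Q) := by rw [htop]; exact Subgroup.mem_top q
      rw [coe_commutator_sup_closure_pow] at hq
      obtain ⟨_, ⟨y, rfl⟩, c, hc, rfl⟩ := Set.mem_mul.mp hq
      refine ⟨QuotientGroup.mk y, ?_⟩
      dsimp only
      rw [← QuotientGroup.mk_pow, QuotientGroup.mk_mul, (QuotientGroup.eq_one_iff c).mpr hc, mul_one]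
  -- hence injective, so are its iterates; but a nontrivial element is killed by some iterate
  have hinj : Function.Injective fun a : Q ⧸ commutator Q => a ^ p :=
    Finite.injective_iff_surjective.mpr hsurj
  obtain ⟨a, ha⟩ := exists_ne (1 : Q ⧸ commutator Q)
  obtain ⟨k, hk⟩ := hA a
  have hiter : ∀ n : ℕ, Function.Injective fun b : Q ⧸ commutator Q => b ^ p ^ n := by
    intro n
    induction n with
    | zero => intro b c h; simpa using h
    | succ n ih =>
      intro b c h
      apply ih
      apply hinj
      dsimp only at h ⊢
      rw [← pow_mul, ← pow_mul, ← pow_succ]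
      exact h
  exact ha (hiter k (by dsimp only; rw [hk, one_pow]))

end FinitePGroup

section Serre

/-- **Serre's theorem, inductive form** (DdSMS Thm 1.17, proof): for every `k`, in every topologically
finitely generated pro-`p` group `G`, a NORMAL subgroup `N` of index `p ^ k` is open.  Induction on
`k` simultaneously over all such `G`: with `Φ = [G,G]·Gᵖ` (open, `isOpen_commutator_sup_closure_pow_of_proP`)
either `N ⊔ Φ = ⊤`, and then `G ⧸ N` is a finite `p`-group with `[Q,Q]·Qᵖ = Q`, i.e. trivial; or
`N ⊔ Φ` is a proper OPEN subgroup, topologically finitely generated and pro-`p`, in which `N` is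
normal of index `p ^ j` with `j < k`. [cite: DDMSAnalyticProP1999, Thm 1.17] -/
theorem isOpen_of_normal_of_index_eq_pow_of_proP (k : ℕ) :
    ∀ {G : Type u} [Group G] [TopologicalSpace G] [IsTopologicalGroup G] [CompactSpace G]
      [TotallyDisconnectedSpace G] {p : ℕ} [Fact p.Prime],
      (∀ U : OpenNormalSubgroup G, IsPGroup p (G ⧸ (U : Subgroup G))) →
      (∃ S : Finset G, Dense ((Subgroup.closure (S : Set G) : Subgroup G) : Set G)) →
      ∀ (N : Subgroup G), N.Normal → N.index = p ^ k → IsOpen (N : Set G) := by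
  induction k using Nat.strong_induction_on with
  | _ k ih =>
    intro G _ _ _ _ _ p hp hP hfg N hN hidx
    -- the open subgroup `Φ = [G,G]·Gᵖ` and `M₁ = N ⊔ Φ`
    set Φ : Subgroup G := commutator G ⊔ Subgroup.closure (Set.range fun x : G => x ^ p) with hΦ
    have hΦopen : IsOpen (Φ : Set G) := isOpen_commutator_sup_closure_pow_of_proP hP hfg
    set M₁ : Subgroup G := N ⊔ Φ with hM₁
    have hM₁open : IsOpen (M₁ : Set G) := Subgroup.isOpen_mono le_sup_right hΦopen
    haveI : N.FiniteIndex := ⟨by rw [hidx]; exact pow_ne_zero _ hp.out.ne_zero⟩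
    haveI : Finite (G ⧸ N) := Subgroup.finite_quotient_of_finiteIndex
    have hNp : IsPGroup p (G ⧸ N) := IsPGroup.of_card (by rw [← Subgroup.index_eq_card, hidx])
    by_cases hM : M₁ = ⊤
    · -- then `G ⧸ N = [Q,Q]·Qᵖ`, so `G ⧸ N` is trivial, `N = ⊤`
      suffices hN1 : N = ⊤ by rw [hN1, Subgroup.coe_top]; exact isOpen_univ
      by_contra hNtop
      haveI : Nontrivial (G ⧸ N) := by
        obtain ⟨x, hx⟩ : ∃ x : G, x ∉ N := by
          by_contra h
          push Not at h
          exact hNtop (eq_top_iff.mpr fun x _ => h x)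
        exact ⟨⟨QuotientGroup.mk x, 1, fun h => hx ((QuotientGroup.eq_one_iff x).mp h)⟩⟩
      apply commutator_sup_closure_pow_ne_top hNp
      -- the image of `Φ` in `G ⧸ N` is everything and lies in `[Q,Q]·Qᵖ`
      have himg : Φ.map (QuotientGroup.mk' N) = ⊤ := by
        have h1 : M₁.map (QuotientGroup.mk' N) = ⊤ := by
          rw [hM, Subgroup.map_top_of_surjective _ (QuotientGroup.mk'_surjective N)]
        rwa [hM₁, Subgroup.map_sup, QuotientGroup.map_mk'_self, bot_sup_eq] at h1
      have hle : Φ.map (QuotientGroup.mk' N) ≤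
          commutator (G ⧸ N) ⊔ Subgroup.closure (Set.range fun x : G ⧸ N => x ^ p) := by
        rw [hΦ, Subgroup.map_sup]
        refine sup_le_sup ?_ ?_
        · rw [commutator, commutator, Subgroup.map_commutator]
          exact Subgroup.commutator_mono le_top le_top
        · rw [MonoidHom.map_closure]
          refine Subgroup.closure_mono ?_
          rintro _ ⟨_, ⟨x, rfl⟩, rfl⟩
          exact ⟨QuotientGroup.mk' N x, (map_pow _ x p).symm⟩
      exact top_le_iff.mp (himg ▸ hle)
    · -- otherwise pass to the proper open subgroup `M₁`, where `N` has index `p ^ j`, `j < k`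
      have hNM₁ : N ≤ M₁ := le_sup_left
      have hmul : N.relIndex M₁ * M₁.index = p ^ k := by rw [Subgroup.relIndex_mul_index hNM₁, hidx]
      have hM₁idx : M₁.index ≠ 1 := fun h => hM (Subgroup.index_eq_one.mp h)
      obtain ⟨j, hjk, hj⟩ : ∃ j, j < k ∧ N.relIndex M₁ = p ^ j := by
        have hdvd : N.relIndex M₁ ∣ p ^ k := Dvd.intro _ hmul
        obtain ⟨j, hjle, hj⟩ := (Nat.dvd_prime_pow hp.out).mp hdvd
        refine ⟨j, lt_of_le_of_ne hjle ?_, hj⟩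
        intro heq
        apply hM₁idx
        rw [heq] at hj
        have hpos : 0 < p ^ k := pow_pos hp.out.pos k
        rw [hj] at hmul
        exact Nat.eq_of_mul_eq_mul_left hpos (hmul.trans (mul_one _).symm)
      -- the open subgroup `M₁` as a compact totally disconnected group, pro-`p` and tfg
      haveI : CompactSpace M₁ :=
        isCompact_iff_compactSpace.mp (M₁.isClosed_of_isOpen hM₁open).isCompact
      have hP₁ : ∀ U : OpenNormalSubgroup M₁, IsPGroup p (M₁ ⧸ (U : Subgroup M₁)) :=
        isPGroup_quotient_openNormalSubgroup_subgroup hP M₁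
      have hfg₁ := exists_finset_dense_closure_of_isOpen hfg M₁ hM₁open
      -- `N` as a normal subgroup of `M₁`, of index `p ^ j`
      haveI : (N.subgroupOf M₁).Normal := hN.subgroupOf M₁
      have hidx₁ : (N.subgroupOf M₁).index = p ^ j := hj
      have hopen₁ : IsOpen ((N.subgroupOf M₁ : Subgroup M₁) : Set M₁) :=
        ih j hjk hP₁ hfg₁ (N.subgroupOf M₁) inferInstance hidx₁
      -- push back to `G` along the open embedding `M₁ ↪ G`
      have himage : Subtype.val '' ((N.subgroupOf M₁ : Subgroup M₁) : Set M₁) = (N : Set G) := by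
        ext g
        constructor
        · rintro ⟨x, hx, rfl⟩
          exact Subgroup.mem_subgroupOf.mp hx
        · intro hg
          exact ⟨⟨g, hNM₁ hg⟩, Subgroup.mem_subgroupOf.mpr hg, rfl⟩
      rw [← himage]
      exact hM₁open.isOpenMap_subtype_val _ hopen₁

variable {G : Type u} [Group G] [TopologicalSpace G] [IsTopologicalGroup G] [CompactSpace G]
  [TotallyDisconnectedSpace G] {p : ℕ} [Fact p.Prime]

/-- **Serre's theorem** (J.-P. Serre; Dixon–du Sautoy–Mann–Segal, *Analytic pro-`p` groups*, Thm 1.17):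
in a topologically finitely generated pro-`p` group every subgroup of finite index is open.
(Reduce to the normal core `N`; `G ⧸ N` is a `p`-group by `isPGroup_quotient_of_finiteIndex_of_proP`;
apply the inductive form.) [cite: DDMSAnalyticProP1999, Thm 1.17]
[cite: SerreGaloisCohomology1997, I §4.2 Exercise 6] -/
theorem isOpen_of_finiteIndex_of_proP
    (hP : ∀ U : OpenNormalSubgroup G, IsPGroup p (G ⧸ (U : Subgroup G)))
    (hfg : ∃ S : Finset G, Dense ((Subgroup.closure (S : Set G) : Subgroup G) : Set G))
    (H : Subgroup G) [H.FiniteIndex] : IsOpen (H : Set G) := by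
  haveI : Finite (G ⧸ H.normalCore) := Subgroup.finite_quotient_of_finiteIndex
  obtain ⟨k, hk⟩ := IsPGroup.iff_card.mp (isPGroup_quotient_of_finiteIndex_of_proP hP H.normalCore)
  have hidx : H.normalCore.index = p ^ k := by rw [Subgroup.index_eq_card, hk]
  exact Subgroup.isOpen_mono (Subgroup.normalCore_le H)
    (isOpen_of_normal_of_index_eq_pow_of_proP k hP hfg H.normalCore inferInstance hidx)

/-- **Strong completeness, continuity form**: every homomorphism from a topologically finitely
generated pro-`p` group to a profinite group is continuous (the preimage of an open normal subgroup
has finite index, hence is open by Serre's theorem). [cite: DDMSAnalyticProP1999, Thm 1.17] -/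
theorem continuous_of_proP_of_finsetDense {K : Type*} [Group K] [TopologicalSpace K]
    [IsTopologicalGroup K] [CompactSpace K] [TotallyDisconnectedSpace K]
    (hP : ∀ U : OpenNormalSubgroup G, IsPGroup p (G ⧸ (U : Subgroup G)))
    (hfg : ∃ S : Finset G, Dense ((Subgroup.closure (S : Set G) : Subgroup G) : Set G))
    (f : G →* K) : Continuous f := by
  apply continuous_of_continuousAt_one f
  rw [ContinuousAt, map_one]
  intro V hV
  obtain ⟨N, hN⟩ := ProfiniteGrp.exist_openNormalSubgroup_sub_open_nhds_of_one
    (isOpen_interior (s := V)) (mem_interior_iff_mem_nhds.mpr hV)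
  haveI : Finite (K ⧸ N.toSubgroup) := N.toSubgroup.quotient_finite_of_isOpen N.isOpen'
  haveI : N.toSubgroup.FiniteIndex := Subgroup.finiteIndex_of_finite_quotient
  haveI : (N.toSubgroup.comap f).FiniteIndex := by
    refine ⟨?_⟩
    rw [Subgroup.index_comap]
    show (N.toSubgroup.subgroupOf f.range).index ≠ 0
    exact Subgroup.FiniteIndex.index_ne_zero
  have hopen : IsOpen ((N.toSubgroup.comap f : Subgroup G) : Set G) :=
    isOpen_of_finiteIndex_of_proP hP hfg _
  exact Filter.mem_of_superset (hopen.mem_nhds (one_mem _))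
    fun x hx => interior_subset (hN hx)

/-- **The named fact `NikolovSegalStatement` RESTRICTED to pro-`p` groups, PROVED**: for every compact
totally disconnected topological group `M` which is pro-`p` (every quotient by an open normal subgroup is
a `p`-group) and topologically finitely generated (a finite subset generates a dense subgroup), every
subgroup of finite index is open.  (The general statement, without "pro-`p`", is the Nikolov–Segal
theorem, `Literature/GroupTheory/NikolovSegal.lean`, NOT proved here.)
[cite: DDMSAnalyticProP1999, Thm 1.17] [cite: NikolovSegal2003, Thm 1.1] -/
theorem nikolovSegalStatement_of_proP :
    ∀ (M : Type u) [Group M] [TopologicalSpace M] [IsTopologicalGroup M] [CompactSpace M]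
      [TotallyDisconnectedSpace M] (p : ℕ) [Fact p.Prime],
      (∀ U : OpenNormalSubgroup M, IsPGroup p (M ⧸ (U : Subgroup M))) →
      (∃ S : Finset M, Dense ((Subgroup.closure (S : Set M) : Subgroup M) : Set M)) →
        ∀ U : Subgroup M, U.FiniteIndex → IsOpen (U : Set M) := by
  intro M _ _ _ _ _ p _ hP hfg U hU
  exact isOpen_of_finiteIndex_of_proP hP hfg U

end Serre

end Literature.GroupTheory
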